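import Summits.HubbardSuperconductivity.HubbardLadder.ClassicalMarginalForms
import Literature.MathematicalPhysics.QuantumLattice.LiebMattisLadder
import Literature.MathematicalPhysics.QuantumLattice.FermionOperators
import HarnessLib


/-!
# Rung R1/R2 — classical-marginal ("diagonal N-representability") cut rows, kind `zcut`

HONEST FRAMING (page 1): ladder R1–R4 with certified numbers; no claim on H/H₀.

FILE SPLIT (filing seat lit g5, LEAN FILING REQUEST #90; gate `lint.size` ≤ 400 lines): the generic §1 — letters,
words, polynomials, the block `zcutForm`, its positivity and the any-state validity / residual-absorption lemmas —
is part 1/2 `ClassicalMarginalForms.lean` (imported here, verbatim); this file is part 2/2: the energy rows (§2),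
the spin letters (§3) and the fermionic letters (§4).  No statement was changed by the split.

Row kind `zcut` of the cell's certificate format (pseudo seat, family F18, PSEUDO.md §14,
TO-ENG.md §A.F18; engines reader predicate REQUESTS L677/L678).  Fix a family of pairwise
COMMUTING, simultaneously DIAGONAL "letters" `Z_a` (`a : α`) on a finite-dimensional Hilbert space
with basis `n` — here literally diagonal matrices `Z_a = diag (s ↦ z a s)` with REAL eigenvalue
tables `z a : n → ℝ` (`zcutLetter`).  Examples: `S^z_x` of any spin (`siteSpin_two_eq_zcutLetter`),
the certificate letter `Z_x = 2 S^z_x ∈ {±1}` of spin ½ (`two_smul_siteSpin_eq_zcutLetter`,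
`spinHalfZVal_sq`), fermionic occupation numbers `n_i ∈ {0, 1}` and their complements `1 − n_i`
(`numberAt_eq_zcutLetter`, `one_sub_numberAt_eq_zcutLetter`).  A word `Π_{a ∈ w} Z_a` is the
diagonal matrix of the pointwise product (`zcutWord_eq_diagonal`) and a real combination
`W = Σ_k a_k Π_{a ∈ w_k} Z_a` is the diagonal matrix of the CLASSICAL polynomial
`s ↦ Σ_k a_k Π_{a ∈ w_k} z a s` (`zcutPoly_eq_diagonal`).  Hence, with

  `h⋆ = max_s Σ_k a_k Π_{a ∈ w_k} z a s`  (a finite maximum the reader recomputes exactly),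

`u·1 − W ⪰ 0` whenever `h⋆ ≤ u` (`posSemidef_sub_zcutPoly`) and so `ω(W) ≤ u` in EVERY state —
ground state or not, any Hamiltonian, filling, boundary condition (`re_map_zcutPoly_le`).  This is
the lattice-bootstrap form of the "diagonal `N`-representability conditions" of quantum chemistry
(linear inequalities on the diagonal of reduced density matrices = facets of the correlation /
boolean-quadric polytope, Deza–Laurent ch. 5; Ayers–Davidson 2006): the joint distribution of
commuting observables in a state is a probability measure, so their moment vector lies in the
marginal polytope; a moment relaxation of bounded degree does not know this (pseudo seat
measurements, PSEUDO.md §14.2–14.3: violated by 0.047 on the 4×4 Heisenberg torus at level d2eom4).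

The certificate BLOCK is `zcutForm z κ u a w = Σ_j κ_j • (u_j·1 − W_j)` with multipliers `κ_j ≥ 0`
and bounds `u_j ≥ h⋆_j` (`posSemidef_zcutForm`); it is positive semidefinite, so it is an
admissible summand of EVERY existing row of this directory through the row's residual slot
(`re_groundStateFunctional_zcutForm_add_ge`, `re_dotProduct_zcutForm_add_mulVec_ge`,
`posSemidef_zcutForm_add_add_smul`) — no new soundness predicate, no sector / parity / uniqueness
hypothesis.  For convenience the energy row with `kkt`, `dcomm` AND `zcut` blocks is spelled out for
any Hermitian matrix (`groundEnergy_ge_of_certificate_kkt_dcomm_zcut`) and for the Heisenberg model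
on a torus of any side, dimension and spin (`heisenbergTorus_groundEnergy_ge_of_certificate_zcut`).
The sub-family F18a (inclusion–exclusion occupation probabilities `ω(Π n_p Π (1 − n_q)) ≥ 0`) is the
case "every letter has a nonnegative table", `zcutWord` itself `⪰ 0` (`posSemidef_zcutWord_of_nonneg`,
`posSemidef_occWord`).

Scope, exactly as proved: finite-dimensional matrix states (torus / cluster rows and vector-state
observable windows).  Thermodynamic-limit window rows (`KKTWindowRowsTL`) would take the block by the
"objective minus block" device of `re_projState_ge_of_window_certificate_d4_kkt_ineq`; that needs
positivity of the box state on the embedded block and is NOT formalised here.  No certificate is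
contained in this file; these are soundness edges for certificates produced and checked elsewhere
(both cell generators must emit the block identically before any certificate uses it).

Sources: M. M. Deza, M. Laurent, Geometry of Cuts and Metrics (1997), ch. 5 (correlation polytope,
boolean quadric polytope); P. W. Ayers, E. R. Davidson, Int. J. Quantum Chem. 106 (2006) 1487
(diagonal N-representability); I. Kull et al. (2024) §5.3 (certificate format with residual);
H. Tasaki (2020) §2.1–2.2, §9.2 (spin and fermion operators).  No new named facts; everything is
proved.
-/

namespace Summit.HubbardSuperconductivity.HubbardLadder

open Matrix Finset Literature.Probability.LatticeModels
  Literature.MathematicalPhysics.QuantumLattice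
  Literature.MathematicalPhysics.QuantumManyBody.StateRelaxation
open scoped Matrix.Norms.L2Operator ComplexOrder MatrixOrder

noncomputable section

/-! ## §2 Energy rows with `kkt`, `dcomm` and `zcut` blocks (any Hermitian matrix) -/

section Rows

variable {n : Type*} [Fintype n] [DecidableEq n]
variable {p : Type*} [Fintype p] [DecidableEq p]
variable {q : Type*} [Fintype q] [DecidableEq q]
variable {α : Type*} {κ : Type*} [Fintype κ] {ι : Type*} [Fintype ι]

/-- **Energy row with `kkt`, `dcomm` and `zcut` blocks and a residual**: for ANY Hermitian `A`, an
identity `A − c·1 = Σ Λᵢⱼ Oᵢᴴ Oⱼ + (Σₖ (A Xₖ − Xₖ A) + Σₗ (Uₗ Yₗ Uₗᴴ − Yₗ))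
  + (kktForm A G B + dcommForm A G' B' + zcutForm z κ u a w + r)`
with `Λ, G, G' ⪰ 0`, unitaries `Uₗ` commuting with `A`, multipliers `κ_j ≥ 0`, bounds passing the
classical test `∀ s, Σ_k a_jk Π z ≤ u_j`, and `−ε ≤ Re ω₀(r)` certifies `c − ε ≤ E₀(A)`.
(For `r = 0` take `ε = 0`.) Kull et al. (2024) §5.3; Araújo et al. (2023) §3.2 Prop. 11.
[cite: KullEtAl2024, §5.3] [cite: AraujoEtAl2023, §3.2 Prop. 11] [cite: DezaLaurent1997, ch. 5] -/
theorem groundEnergy_ge_of_certificate_kkt_dcomm_zcut [Nonempty n] {A : Matrix n n ℂ}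
    (hA : A.IsHermitian)
    {m' : Type*} [Fintype m'] [DecidableEq m'] {Λ : Matrix m' m' ℂ} (hΛ : Λ.PosSemidef)
    (O : m' → Matrix n n ℂ)
    {ι₁ : Type*} (s : Finset ι₁) (X : ι₁ → Matrix n n ℂ)
    {ι₂ : Type*} (t : Finset ι₂) (U Y : ι₂ → Matrix n n ℂ)
    (hU : ∀ l ∈ t, U l * A = A * U l) (hUU : ∀ l ∈ t, (U l)ᴴ * U l = 1)
    {G : Matrix p p ℂ} (hG : G.PosSemidef) (B : p → Matrix n n ℂ)
    {G' : Matrix q q ℂ} (hG' : G'.PosSemidef) (B' : q → Matrix n n ℂ)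
    (z : α → n → ℝ) {κ' u : ι → ℝ} (a : ι → κ → ℝ) (w : ι → κ → List α)
    (hκ : ∀ j, 0 ≤ κ' j) (hu : ∀ j s', zcutPolyEval z (a j) (w j) s' ≤ u j)
    {r : Matrix n n ℂ} {ε : ℝ} (hr : -ε ≤ (A.groundStateFunctional r).re) {c : ℝ}
    (hcert : A - (c : ℂ) • (1 : Matrix n n ℂ) =
      gramForm Λ O +
        (∑ b ∈ s, (A * X b - X b * A) + ∑ l ∈ t, (U l * Y l * (U l)ᴴ - Y l)) +
        (kktForm A G B + dcommForm A G' B' + zcutForm z κ' u a w + r)) :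
    c - ε ≤ A.groundEnergy :=
  groundEnergy_ge_of_certificate_kkt_dcomm hA hΛ O s X t U Y hU hUU hG B hG' B'
    (r := zcutForm z κ' u a w + r) (re_groundStateFunctional_zcutForm_add_ge A z a w hκ hu hr)
    (by rw [hcert, add_assoc (kktForm A G B + dcommForm A G' B')])

/-- **Energy row with a `zcut` block only** (Gram + nulls + zcut + residual): `c − ε ≤ E₀(A)` for ANY
Hermitian `A`. Kull et al. (2024) §5.3. [cite: KullEtAl2024, §5.3] [cite: DezaLaurent1997, ch. 5] -/
theorem groundEnergy_ge_of_certificate_zcut [Nonempty n] {A : Matrix n n ℂ} (hA : A.IsHermitian)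
    {m' : Type*} [Fintype m'] [DecidableEq m'] {Λ : Matrix m' m' ℂ} (hΛ : Λ.PosSemidef)
    (O : m' → Matrix n n ℂ)
    {ι₁ : Type*} (s : Finset ι₁) (X : ι₁ → Matrix n n ℂ)
    {ι₂ : Type*} (t : Finset ι₂) (U Y : ι₂ → Matrix n n ℂ)
    (hU : ∀ l ∈ t, U l * A = A * U l) (hUU : ∀ l ∈ t, (U l)ᴴ * U l = 1)
    (z : α → n → ℝ) {κ' u : ι → ℝ} (a : ι → κ → ℝ) (w : ι → κ → List α)
    (hκ : ∀ j, 0 ≤ κ' j) (hu : ∀ j s', zcutPolyEval z (a j) (w j) s' ≤ u j)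
    {r : Matrix n n ℂ} {ε : ℝ} (hr : -ε ≤ (A.groundStateFunctional r).re) {c : ℝ}
    (hcert : A - (c : ℂ) • (1 : Matrix n n ℂ) =
      gramForm Λ O +
        (∑ b ∈ s, (A * X b - X b * A) + ∑ l ∈ t, (U l * Y l * (U l)ᴴ - Y l)) +
        (zcutForm z κ' u a w + r)) :
    c - ε ≤ A.groundEnergy := by
  set ω := A.groundStateFunctional with hω
  have hpos : ∀ x : Matrix n n ℂ, 0 ≤ ω (star x * x) := fun x => by
    rw [hω, Matrix.star_eq_conjTranspose]; exact groundStateFunctional_nonneg A x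
  have hone : ω 1 = 1 := groundStateFunctional_one hA
  have hnull : ω (∑ b ∈ s, (A * X b - X b * A) + ∑ l ∈ t, (U l * Y l * (U l)ᴴ - Y l)) = 0 := by
    rw [map_add, map_sum, map_sum]
    have h1 : ∀ b ∈ s, ω (A * X b - X b * A) = 0 := fun b _ => by
      rw [map_sub, hω, groundStateFunctional_hamiltonian_mul hA,
        groundStateFunctional_mul_hamiltonian, sub_self]
    have h2 : ∀ l ∈ t, ω (U l * Y l * (U l)ᴴ - Y l) = 0 := fun l hl => by
      rw [map_sub, hω, groundStateFunctional_conj_of_commute hA (hU l hl) (hUU l hl), sub_self]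
    rw [Finset.sum_eq_zero h1, Finset.sum_eq_zero h2, add_zero]
  have hr' : -ε ≤ (ω (zcutForm z κ' u a w + r)).re := re_map_zcutForm_add_ge ω hpos z a w hκ hu hr
  have h := le_re_map_of_certificate_residual ω hpos hone hΛ O hnull hr' hcert
  rw [hω, groundStateFunctional_hamiltonian hA, Complex.ofReal_re] at h
  exact h

end Rows

/-! ## §3 Spin letters: `S^z_x` and the certificate letter `Z_x = 2 S^z_x ∈ {±1}` -/

section Spins

variable {Λ : Type*} [Fintype Λ] [DecidableEq Λ]

/-- Eigenvalue table of `S^z_x` (spin `S = n/2`) in the tensor basis: `σ ↦ n/2 − σ x`.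
Tasaki (2020) §2.1, eq. (2.1.5). [cite: Tasaki2020] -/
def spinZVal (n : ℕ) (x : Λ) (σ : TensorIndex Λ (n + 1)) : ℝ :=
  (n : ℝ) / 2 - ((σ x : ℕ) : ℝ)

/-- `S^z_x` is the diagonal letter with table `spinZVal n`. Tasaki (2020) §2.2, eq. (2.2.5). [cite: Tasaki2020] -/
theorem siteSpin_two_eq_zcutLetter (n : ℕ) (x : Λ) :
    (siteSpin n x 2 : Op Λ (n + 1)) = zcutLetter (spinZVal n) x := by
  rw [siteSpin, spinVec_two, SpinOperators.spinZ, LiebMattis.onSite_diagonal, zcutLetter]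
  congr 1
  funext σ
  simp only [spinZVal]
  push_cast
  ring

/-- Eigenvalue table of the certificate letter `Z_x = 2 S^z_x` of spin ½: `σ ↦ 1 − 2 σ x ∈ {±1}`.
Tasaki (2020) §2.1, eq. (2.1.8). [cite: Tasaki2020] -/
def spinHalfZVal (x : Λ) (σ : TensorIndex Λ 2) : ℝ :=
  1 - 2 * ((σ x : ℕ) : ℝ)

/-- `Z_x = 2 S^z_x` (spin ½) is the diagonal letter with table `spinHalfZVal` — so a `zcut` row over
spin-½ `Z`-words is an instance of `zcutPoly spinHalfZVal`. Tasaki (2020) §2.1, eq. (2.1.8). [cite: Tasaki2020] -/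
theorem two_smul_siteSpin_eq_zcutLetter (x : Λ) :
    ((2 : ℂ) • siteSpin 1 x 2 : Op Λ 2) = zcutLetter spinHalfZVal x := by
  rw [siteSpin_two_eq_zcutLetter, zcutLetter, zcutLetter, ← diagonal_smul]
  congr 1
  funext σ
  simp only [Pi.smul_apply, smul_eq_mul, spinZVal, spinHalfZVal]
  push_cast
  ring

omit [Fintype Λ] [DecidableEq Λ] in
/-- The letter values are `±1`: the reader's maximum over `{±1}^S` is the maximum over tensor basis
states. Tasaki (2020) §2.1. [cite: Tasaki2020] -/
theorem spinHalfZVal_eq_one_or (x : Λ) (σ : TensorIndex Λ 2) :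
    spinHalfZVal x σ = 1 ∨ spinHalfZVal x σ = -1 := by
  unfold spinHalfZVal
  generalize σ x = k
  fin_cases k
  · left; simp
  · right; norm_num

omit [Fintype Λ] [DecidableEq Λ] in
/-- `Z_x² = 1` at the level of tables. Tasaki (2020) §2.1. [cite: Tasaki2020] -/
theorem spinHalfZVal_sq (x : Λ) (σ : TensorIndex Λ 2) : spinHalfZVal x σ ^ 2 = 1 := by
  rcases spinHalfZVal_eq_one_or x σ with h | h <;> rw [h] <;> norm_num

variable {d : ℕ} {p : Type*} [Fintype p] [DecidableEq p] {q : Type*} [Fintype q] [DecidableEq q]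
variable {α : Type*} {κ : Type*} [Fintype κ] {ι : Type*} [Fintype ι]

/-- **Heisenberg-torus energy row with `kkt`, `dcomm` and `zcut` blocks** (any side `L`, dimension
`d`, spin `n/2`, sign of `J`; letters typically `z = spinHalfZVal` for `n = 1` or `spinZVal n`):
`c − ε ≤ E₀(H)`. Kull et al. (2024) §5.3; Araújo et al. (2023) §3.2 Prop. 11.
[cite: KullEtAl2024, §5.3] [cite: AraujoEtAl2023, §3.2 Prop. 11] [cite: DezaLaurent1997, ch. 5] -/
theorem heisenbergTorus_groundEnergy_ge_of_certificate_zcut (L : ℕ) [NeZero L] (n : ℕ) (J : ℝ)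
    {m' : Type*} [Fintype m'] [DecidableEq m'] {Λm : Matrix m' m' ℂ} (hΛ : Λm.PosSemidef)
    (O : m' → Op (TorusSite d L) (n + 1))
    {ι₁ : Type*} (s : Finset ι₁) (X : ι₁ → Op (TorusSite d L) (n + 1))
    {ι₂ : Type*} (t : Finset ι₂) (U Y : ι₂ → Op (TorusSite d L) (n + 1))
    (hU : ∀ l ∈ t, U l * heisenbergTorus d L n J = heisenbergTorus d L n J * U l)
    (hUU : ∀ l ∈ t, (U l)ᴴ * U l = 1)
    {G : Matrix p p ℂ} (hG : G.PosSemidef) (B : p → Op (TorusSite d L) (n + 1))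
    {G' : Matrix q q ℂ} (hG' : G'.PosSemidef) (B' : q → Op (TorusSite d L) (n + 1))
    (z : α → TensorIndex (TorusSite d L) (n + 1) → ℝ) {κ' u : ι → ℝ} (a : ι → κ → ℝ)
    (w : ι → κ → List α) (hκ : ∀ j, 0 ≤ κ' j) (hu : ∀ j σ, zcutPolyEval z (a j) (w j) σ ≤ u j)
    {r : Op (TorusSite d L) (n + 1)} {ε : ℝ}
    (hr : -ε ≤ ((heisenbergTorus d L n J).groundStateFunctional r).re) {c : ℝ}
    (hcert : heisenbergTorus d L n J - (c : ℂ) • (1 : Op (TorusSite d L) (n + 1)) =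
      gramForm Λm O +
        (∑ b ∈ s, (heisenbergTorus d L n J * X b - X b * heisenbergTorus d L n J) +
          ∑ l ∈ t, (U l * Y l * (U l)ᴴ - Y l)) +
        (kktForm (heisenbergTorus d L n J) G B + dcommForm (heisenbergTorus d L n J) G' B' +
          zcutForm z κ' u a w + r)) :
    c - ε ≤ (heisenbergTorus d L n J).groundEnergy :=
  groundEnergy_ge_of_certificate_kkt_dcomm_zcut (heisenbergHamiltonian_isHermitian n _ J) hΛ O s X t
    U Y hU hUU hG B hG' B' z a w hκ hu hr hcert

end Spins

/-! ## §4 Fermionic letters: occupation numbers and their complements (F18a) -/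

section Fermions

variable {ι₀ : Type*} [LinearOrder ι₀] [Fintype ι₀]

/-- Occupation tables on the fermionic Fock basis `Finset ι₀`: the letter `(i, true)` is `n_i`
(`s ↦ [i ∈ s]`), the letter `(i, false)` its complement `1 − n_i` (`s ↦ [i ∉ s]`); all values lie in
`{0, 1}`. Tasaki (2020) §9.2. [cite: Tasaki2020] -/
def occVal (l : ι₀ × Bool) (s : Finset ι₀) : ℝ :=
  if l.2 then (if l.1 ∈ s then 1 else 0) else (if l.1 ∈ s then 0 else 1)

omit [Fintype ι₀] in
/-- Occupation tables are nonnegative. Tasaki (2020) §9.2. [cite: Tasaki2020] -/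
theorem occVal_nonneg (l : ι₀ × Bool) (s : Finset ι₀) : 0 ≤ occVal l s := by
  unfold occVal
  split_ifs <;> norm_num

/-- `n_i` is the diagonal letter `(i, true)`. Tasaki (2020) §9.2. [cite: Tasaki2020] -/
theorem numberAt_eq_zcutLetter (i : ι₀) :
    numberAt i = zcutLetter occVal (i, true) := by
  rw [numberAt_eq_diagonal, zcutLetter]
  congr 1
  funext s
  by_cases hs : i ∈ s <;> simp [occVal, hs]

/-- `1 − n_i` is the diagonal letter `(i, false)`. Tasaki (2020) §9.2. [cite: Tasaki2020] -/
theorem one_sub_numberAt_eq_zcutLetter (i : ι₀) :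
    1 - numberAt i = zcutLetter occVal (i, false) := by
  rw [numberAt_eq_diagonal, zcutLetter, ← diagonal_one, diagonal_sub]
  congr 1
  funext s
  by_cases hs : i ∈ s <;> simp [occVal, hs]

/-- **F18a for fermions**: every word in occupation numbers and their complements,
`Π_{p ∈ P} n_p · Π_{q ∈ Q} (1 − n_q)` (the inclusion–exclusion occupation "probability operator"), is
`⪰ 0`; hence `0 ≤ ω(word)` in every state (`map_nonneg_of_posSemidef`) — a `zcut` row with `u = 0`
for `−word`. Ayers–Davidson (2006) §2. [cite: DezaLaurent1997, ch. 5] [cite: Tasaki2020] -/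
theorem posSemidef_occWord (w : List (ι₀ × Bool)) : (zcutWord occVal w).PosSemidef :=
  posSemidef_zcutWord_of_nonneg occVal_nonneg w

/-- In particular `0 ≤ Re ω(Π n_p Π (1 − n_q))` for every positive functional `ω` on the Fock space.
Ayers–Davidson (2006) §2. [cite: DezaLaurent1997, ch. 5] [cite: Tasaki2020] -/
theorem re_map_occWord_nonneg (ω : Matrix (Finset ι₀) (Finset ι₀) ℂ →ₗ[ℂ] ℂ)
    (hpos : ∀ x, 0 ≤ ω (star x * x)) (w : List (ι₀ × Bool)) :
    0 ≤ (ω (zcutWord occVal w)).re :=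
  (Complex.nonneg_iff.mp (map_nonneg_of_posSemidef ω hpos (posSemidef_occWord w))).1

end Fermions

end

end Summit.HubbardSuperconductivity.HubbardLadder
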